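import Mathlib
import Summits.Ventures.HodgeRepro.Tier4.Common.LocalCoordinatesConj
import Summits.Ventures.HodgeRepro.Tier4.Line4.D3CoeffDecayConj

/-!
# Tier4/Line4/D3CoeffDecayDefinite — C-L4-D3DECAY, part 3: at a DEFINITE real CM place the `ℓ¹` size is BOUNDED
(`U(2)` is compact), so `HasDecay3 W D3coeff'` holds WITHOUT a bump when every place `w′ ≠ w₀` is definite

Blind re-derivation cell `pub-hodge-repro`, Tier 4 (README §9–§10), seat t4-L1-p5 (prover, gen 4; cut C-L4-D3DECAY,
S14971; crit-1's record note S15046 «at DEFINITE places `bump = 1` serves»; paper proofs/t4/L4/D3COEFF-t4-L1-p5.md §7).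
Target tree path `lean/Summits/Ventures/HodgeRepro/Tier4/Line4/D3CoeffDecayDefinite.lean`.  On parts 1–2
(`D3CoeffDecay` p701467, `D3CoeffDecayConj` p701824) and typer-2's `LocalUnitary` row relations; no printed input.

WHAT IS PROVED.  At a real CM place `w` where the Hermitian form of the row plane is DEFINITE — `a_w · (εb)_w > 0`
(both signs equal; positive or negative definite) — the unitary row relations `a_w ‖α‖² + (εb)_w ‖β‖² = a_w`,
`a_w ‖γ‖² + (εb)_w ‖δ‖² = (εb)_w` (LocalUnitary) give `‖α‖, ‖δ‖ ≤ 1`, `‖β‖² ≤ a_w/(εb)_w`, `‖γ‖² ≤ (εb)_w/a_w`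
(`normSq_locEntry_le_of_definite`, `norm_locEntry_le_of_definite`): the `w`-block ranges over the compact `U(2)`.  Hence
* `sum_norm_adToC_mat_le_of_definite` — `∑ᵢⱼ ‖adToC w (mat g i j)‖ ≤ 16 · blockBound q w · C₁⁺` on the row plane,
  `C₁⁺ = 1 + √(a_w/(εb)_w) + √((εb)_w/a_w)`, UNIFORMLY in `g`;
* `sum_norm_adToC_mat_le_of_definite'` — the same on the seesaw plane through `conjTo`
  (`≤ ‖adMat g‖₁ ‖adMat g′‖₁ · 16 · blockBound · C₁⁺`);
* **`hasDecay3_D3coeff'_of_definite`** — if `w` is the only indefinite real place of the conjugate plane (`U(1,1)` at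
  `w`: `0 < a₁_w`, `(−a₃)_w < 0`; DEFINITE at every `w′ ≠ w`: `w′` real CM with `a₁_{w′} · (−a₃)_{w′} > 0`), then
  `∃ C, ∀ x, ‖D3coeff' x‖ ≤ C · exp (−(3 · ∑_{w′} log (max 1 (∑ᵢⱼ ‖adToC w′ (mat x i j)‖))))` — plan-4's
  `HasDecay3 W D3coeff'` with NO bump: `hasDecay3_of_bump` at `bump = 1`, `B = 1`, `M = 1 + ∑_{w′} K_{w′}` with
  `K_{w′}` the definite-place bound.  The bump of part 2 is needed only at INDEFINITE places `w′ ≠ w` (if any).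

Nothing here says anything about the status of the Hodge conjecture for CM abelian varieties, which is NOT proved
(HC_CM is NOT proved by anyone in this repository).
-/

set_option autoImplicit false

noncomputable section

namespace Summit.Ventures.HodgeRepro.Tier4.Line4

open Summit.Ventures.HodgeRepro.Tier4.Common NumberField Matrix

section Definite

variable {k : Type} [Field k] [NumberField k] (q : QuadData k) (a b ε : k) (w : InfinitePlace k)
  (hw : w.IsReal) (hcm : IsCMAt q w)

include hw hcm in
/-- **the `U(2)` bounds** at a definite place (`a_w · (εb)_w > 0`): `‖α‖² ≤ 1`, `‖β‖² ≤ a_w/(εb)_w`,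
`‖γ‖² ≤ (εb)_w/a_w`, `‖δ‖² ≤ 1` (the two unitary row relations, divided by `a_w` resp. `(εb)_w`). -/
theorem normSq_locEntry_le_of_definite
    (hdef : 0 < (adToC w (algebraMap k (Ad k) a)).re * (adToC w (algebraMap k (Ad k) (ε * b))).re)
    (g : GA (PlaneData.ofLinesRow q a b ε)) :
    Complex.normSq (locEntry q a b ε w g 0 0) ≤ 1 ∧
      Complex.normSq (locEntry q a b ε w g 0 1) ≤
        (adToC w (algebraMap k (Ad k) a)).re / (adToC w (algebraMap k (Ad k) (ε * b))).re ∧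
      Complex.normSq (locEntry q a b ε w g 1 0) ≤
        (adToC w (algebraMap k (Ad k) (ε * b))).re / (adToC w (algebraMap k (Ad k) a)).re ∧
      Complex.normSq (locEntry q a b ε w g 1 1) ≤ 1 := by
  have hq := disc_ne_zero_of_isCMAt q w hw hcm
  set A := (adToC w (algebraMap k (Ad k) a)).re with hA
  set Bv := (adToC w (algebraMap k (Ad k) (ε * b))).re with hBv
  set nA := Complex.normSq (locEntry q a b ε w g 0 0) with hnA
  set nB := Complex.normSq (locEntry q a b ε w g 0 1) with hnB
  set nG := Complex.normSq (locEntry q a b ε w g 1 0) with hnG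
  set nD := Complex.normSq (locEntry q a b ε w g 1 1) with hnD
  have r0 : A * nA + Bv * nB = A := normSq_entry_sub_normSq q a b ε w hw hcm hq g
  have r1 : A * nG + Bv * nD = Bv := normSq_row_one q a b ε w hw hcm g
  have hA0 : A ≠ 0 := fun h => by rw [h, zero_mul] at hdef; exact lt_irrefl _ hdef
  have hB0 : Bv ≠ 0 := fun h => by rw [h, mul_zero] at hdef; exact lt_irrefl _ hdef
  have hr : 0 < Bv / A := by
    have : Bv / A = (A * Bv) / A ^ 2 := by field_simp
    rw [this]; positivity
  have hr' : 0 < A / Bv := by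
    have : A / Bv = (A * Bv) / Bv ^ 2 := by field_simp
    rw [this]; positivity
  have hnA0 : 0 ≤ nA := Complex.normSq_nonneg _
  have hnB0 : 0 ≤ nB := Complex.normSq_nonneg _
  have hnG0 : 0 ≤ nG := Complex.normSq_nonneg _
  have hnD0 : 0 ≤ nD := Complex.normSq_nonneg _
  -- row 0 divided by `A`: `nA + (Bv/A) nB = 1`; row 1 divided by `Bv`: `(A/Bv) nG + nD = 1`
  have e0 : nA + Bv / A * nB = 1 := by
    field_simp
    linear_combination r0
  have e1 : A / Bv * nG + nD = 1 := by
    field_simp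
    linear_combination r1
  have hrB : 0 ≤ Bv / A * nB := mul_nonneg hr.le hnB0
  have hrG : 0 ≤ A / Bv * nG := mul_nonneg hr'.le hnG0
  refine ⟨by linarith, ?_, ?_, by linarith⟩
  · -- `nB ≤ A/Bv`: `(Bv/A) nB ≤ 1` and `A/Bv = (Bv/A)⁻¹`
    have h1 : Bv / A * nB ≤ 1 := by linarith
    have e : A / Bv = 1 / (Bv / A) := by rw [one_div, inv_div]
    rw [e, le_div_iff₀ hr]
    linarith [mul_comm nB (Bv / A)]
  · have h1 : A / Bv * nG ≤ 1 := by linarith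
    have e : Bv / A = 1 / (A / Bv) := by rw [one_div, inv_div]
    rw [e, le_div_iff₀ hr']
    linarith [mul_comm nG (A / Bv)]

include hw hcm in
/-- **every coordinate is bounded by `C₁⁺ := 1 + √(a_w/(εb)_w) + √((εb)_w/a_w)`** at a definite place, uniformly in
`g`. -/
theorem norm_locEntry_le_of_definite
    (hdef : 0 < (adToC w (algebraMap k (Ad k) a)).re * (adToC w (algebraMap k (Ad k) (ε * b))).re)
    (g : GA (PlaneData.ofLinesRow q a b ε)) (I J : Fin 2) :
    ‖locEntry q a b ε w g I J‖ ≤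
      1 + Real.sqrt ((adToC w (algebraMap k (Ad k) a)).re / (adToC w (algebraMap k (Ad k) (ε * b))).re) +
        Real.sqrt ((adToC w (algebraMap k (Ad k) (ε * b))).re / (adToC w (algebraMap k (Ad k) a)).re) := by
  obtain ⟨hA, hB, hG, hD⟩ := normSq_locEntry_le_of_definite q a b ε w hw hcm hdef g
  set s1 := Real.sqrt ((adToC w (algebraMap k (Ad k) a)).re / (adToC w (algebraMap k (Ad k) (ε * b))).re) with hs1
  set s2 := Real.sqrt ((adToC w (algebraMap k (Ad k) (ε * b))).re / (adToC w (algebraMap k (Ad k) a)).re) with hs2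
  have hs10 : 0 ≤ s1 := Real.sqrt_nonneg _
  have hs20 : 0 ≤ s2 := Real.sqrt_nonneg _
  have key : ∀ (r : ℝ) (z : ℂ), Complex.normSq z ≤ r → ‖z‖ ≤ Real.sqrt r := by
    intro r z hz
    have h1 : ‖z‖ = Real.sqrt (Complex.normSq z) := by
      rw [Complex.normSq_eq_norm_sq, Real.sqrt_sq (norm_nonneg _)]
    rw [h1]
    exact Real.sqrt_le_sqrt hz
  fin_cases I <;> fin_cases J
  · have h := key _ _ hA
    rw [Real.sqrt_one] at h
    show ‖locEntry q a b ε w g 0 0‖ ≤ 1 + s1 + s2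
    linarith
  · have h := key _ _ hB
    show ‖locEntry q a b ε w g 0 1‖ ≤ 1 + s1 + s2
    linarith
  · have h := key _ _ hG
    show ‖locEntry q a b ε w g 1 0‖ ≤ 1 + s1 + s2
    linarith
  · have h := key _ _ hD
    rw [Real.sqrt_one] at h
    show ‖locEntry q a b ε w g 1 1‖ ≤ 1 + s1 + s2
    linarith

include hw hcm in
/-- **THE SIZE IS BOUNDED AT A DEFINITE PLACE**: `∑ᵢⱼ ‖adToC w (mat g i j)‖ ≤ 16 · blockBound q w · C₁⁺` for every
`g` (the `w`-block ranges over the compact `U(2)`). -/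
theorem sum_norm_adToC_mat_le_of_definite
    (hdef : 0 < (adToC w (algebraMap k (Ad k) a)).re * (adToC w (algebraMap k (Ad k) (ε * b))).re)
    (g : GA (PlaneData.ofLinesRow q a b ε)) :
    ∑ i : Fin 4, ∑ j : Fin 4, ‖adToC w (GA.mat (PlaneData.ofLinesRow q a b ε) g i j)‖ ≤
      16 * blockBound q w *
        (1 + Real.sqrt ((adToC w (algebraMap k (Ad k) a)).re / (adToC w (algebraMap k (Ad k) (ε * b))).re) +
          Real.sqrt ((adToC w (algebraMap k (Ad k) (ε * b))).re / (adToC w (algebraMap k (Ad k) a)).re)) := by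
  set C₁ := 1 + Real.sqrt ((adToC w (algebraMap k (Ad k) a)).re / (adToC w (algebraMap k (Ad k) (ε * b))).re) +
    Real.sqrt ((adToC w (algebraMap k (Ad k) (ε * b))).re / (adToC w (algebraMap k (Ad k) a)).re) with hC₁
  set M := GA.mat (PlaneData.ofLinesRow q a b ε) g with hM
  rw [sum_norm_entries_eq_blocks]
  have hblock : ∀ I J : Fin 2, ∑ i : Fin 2, ∑ j : Fin 2, ‖adToC w (blocksOf M I J i j)‖ ≤
      4 * (blockBound q w * C₁) := by
    intro I J
    have hentry : ∀ i j : Fin 2, ‖adToC w (blocksOf M I J i j)‖ ≤ blockBound q w * C₁ := by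
      intro i j
      have hloc : locEntry q a b ε w g I J =
          blockWeight q w (M (lineBase I) (lineBase J)) (M (lineOmega I) (lineBase J)) := by
        rw [locEntry_eq_blockWeight, blocks_eq_blockOf, blockOf_apply_zero_zero, blockOf_apply_one_zero]
      calc ‖adToC w (blocksOf M I J i j)‖
          ≤ blockBound q w * ‖blockWeight q w (M (lineBase I) (lineBase J)) (M (lineOmega I) (lineBase J))‖ := by
            rw [hM, blocks_eq_blockOf]
            exact norm_adToC_blockOf_le q hw hcm _ _ i j
        _ = blockBound q w * ‖locEntry q a b ε w g I J‖ := by rw [hloc]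
        _ ≤ blockBound q w * C₁ :=
            mul_le_mul_of_nonneg_left (norm_locEntry_le_of_definite q a b ε w hw hcm hdef g I J)
              (blockBound_nonneg q w)
    calc ∑ i : Fin 2, ∑ j : Fin 2, ‖adToC w (blocksOf M I J i j)‖
        ≤ ∑ i : Fin 2, ∑ j : Fin 2, blockBound q w * C₁ :=
          Finset.sum_le_sum fun i _ => Finset.sum_le_sum fun j _ => hentry i j
      _ = 4 * (blockBound q w * C₁) := by simp; ring
  calc ∑ I : Fin 2, ∑ J : Fin 2, ∑ i : Fin 2, ∑ j : Fin 2, ‖adToC w (blocksOf M I J i j)‖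
      ≤ ∑ I : Fin 2, ∑ J : Fin 2, 4 * (blockBound q w * C₁) :=
        Finset.sum_le_sum fun I _ => Finset.sum_le_sum fun J _ => hblock I J
    _ = 16 * blockBound q w * C₁ := by simp; ring

end Definite

section Seesaw

variable {k : Type} [Field k] [NumberField k] (q : QuadData k) (a : Fin 4 → k)
  (g g' : Matrix (Fin 4) (Fin 4) k) (hgg' : g * g' = 1) (hg'g : g' * g = 1)
  (hgΩ : g * (PlaneData.mixedRow q (a 0) (a 2)).Ω = (PlaneData.mixedRow q (a 0) (a 2)).Ω * g)
  (lam : k) (hlam : lam ≠ 0)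
  (hiso : g * (PlaneData.mixedRow q (a 1) (a 3)).B * gᵀ = lam • (PlaneData.mixedRow q (a 0) (a 2)).B)

/-- the definite-place bound of the seesaw plane at `w`, as a real constant of `(q, a, g, g′, w)`:
`‖adMat g‖₁ · ‖adMat g′‖₁ · 16 · blockBound q w · C₁⁺(w)`. -/
def definiteSizeBound (w : InfinitePlace k) : ℝ :=
  (∑ i : Fin 4, ∑ j : Fin 4, ‖adToC w (adMat k g i j)‖) * (∑ i : Fin 4, ∑ j : Fin 4, ‖adToC w (adMat k g' i j)‖) *
    (16 * blockBound q w *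
      (1 + Real.sqrt ((adToC w (algebraMap k (Ad k) (a 1))).re / (adToC w (algebraMap k (Ad k) (-1 * a 3))).re) +
        Real.sqrt ((adToC w (algebraMap k (Ad k) (-1 * a 3))).re / (adToC w (algebraMap k (Ad k) (a 1))).re)))

/-- `0 ≤ definiteSizeBound`. -/
theorem definiteSizeBound_nonneg (w : InfinitePlace k) : 0 ≤ definiteSizeBound q a g g' w := by
  unfold definiteSizeBound
  have h1 : 0 ≤ ∑ i : Fin 4, ∑ j : Fin 4, ‖adToC w (adMat k g i j)‖ :=
    Finset.sum_nonneg fun _ _ => Finset.sum_nonneg fun _ _ => norm_nonneg _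
  have h2 : 0 ≤ ∑ i : Fin 4, ∑ j : Fin 4, ‖adToC w (adMat k g' i j)‖ :=
    Finset.sum_nonneg fun _ _ => Finset.sum_nonneg fun _ _ => norm_nonneg _
  have h3 := blockBound_nonneg q w
  have h4 := Real.sqrt_nonneg ((adToC w (algebraMap k (Ad k) (a 1))).re / (adToC w (algebraMap k (Ad k) (-1 * a 3))).re)
  have h5 := Real.sqrt_nonneg ((adToC w (algebraMap k (Ad k) (-1 * a 3))).re / (adToC w (algebraMap k (Ad k) (a 1))).re)
  positivity

include hlam hiso in
/-- **THE SIZE IS BOUNDED AT A DEFINITE PLACE OF THE SEESAW PLANE**: `∑ᵢⱼ ‖adToC w (mat x i j)‖ ≤ definiteSizeBound w`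
for every `x` (through `conjTo` and the sub-multiplicativity of the `ℓ¹` size). -/
theorem sum_norm_adToC_mat_le_of_definite' (w : InfinitePlace k) (hw : w.IsReal) (hcm : IsCMAt q w)
    (hdef : 0 < (adToC w (algebraMap k (Ad k) (a 1))).re * (adToC w (algebraMap k (Ad k) (-1 * a 3))).re)
    (x : GA ((PlaneData.mixedRow q (a 0) (a 2)).withTransportedTorus g g' hgg' hg'g hgΩ)) :
    ∑ i : Fin 4, ∑ j : Fin 4,
        ‖adToC w (GA.mat ((PlaneData.mixedRow q (a 0) (a 2)).withTransportedTorus g g' hgg' hg'g hgΩ) x i j)‖ ≤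
      definiteSizeBound q a g g' w := by
  have _hlam := hlam
  rw [mat_eq_adMat_mul_mat_conjTo q a g g' hgg' hg'g hgΩ lam hiso x]
  unfold definiteSizeBound
  set N := GA.mat (PlaneData.ofLinesRow q (a 1) (a 3) (-1)) (conjTo q a g g' hgg' hg'g hgΩ lam hiso x) with hN
  set Sg := ∑ i : Fin 4, ∑ j : Fin 4, ‖adToC w (adMat k g i j)‖ with hSg
  set Sg' := ∑ i : Fin 4, ∑ j : Fin 4, ‖adToC w (adMat k g' i j)‖ with hSg'
  set K := 16 * blockBound q w *
    (1 + Real.sqrt ((adToC w (algebraMap k (Ad k) (a 1))).re / (adToC w (algebraMap k (Ad k) (-1 * a 3))).re) +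
      Real.sqrt ((adToC w (algebraMap k (Ad k) (-1 * a 3))).re / (adToC w (algebraMap k (Ad k) (a 1))).re)) with hK
  have hSg0 : 0 ≤ Sg := Finset.sum_nonneg fun _ _ => Finset.sum_nonneg fun _ _ => norm_nonneg _
  have hSg'0 : 0 ≤ Sg' := Finset.sum_nonneg fun _ _ => Finset.sum_nonneg fun _ _ => norm_nonneg _
  have hrow : ∑ i : Fin 4, ∑ j : Fin 4, ‖adToC w (N i j)‖ ≤ K :=
    sum_norm_adToC_mat_le_of_definite q (a 1) (a 3) (-1) w hw hcm hdef (conjTo q a g g' hgg' hg'g hgΩ lam hiso x)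
  calc ∑ i : Fin 4, ∑ j : Fin 4, ‖adToC w ((adMat k g * N * adMat k g') i j)‖
      ≤ (∑ i : Fin 4, ∑ j : Fin 4, ‖adToC w ((adMat k g * N) i j)‖) * Sg' := sum_norm_adToC_mul_le w _ _
    _ ≤ (Sg * ∑ i : Fin 4, ∑ j : Fin 4, ‖adToC w (N i j)‖) * Sg' :=
        mul_le_mul_of_nonneg_right (sum_norm_adToC_mul_le w _ _) hSg'0
    _ ≤ (Sg * K) * Sg' := mul_le_mul_of_nonneg_right (mul_le_mul_of_nonneg_left hrow hSg0) hSg'0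
    _ = Sg * Sg' * K := by ring

include hlam in
/-- **`HasDecay3 W D3coeff'` WITHOUT A BUMP** when `w` is the only indefinite place: `U(1,1)` at `w`
(`0 < a₁_w`, `(−a₃)_w < 0`) and DEFINITE at every real CM place `w′ ≠ w` (`a₁_{w′} · (−a₃)_{w′} > 0`) —
`∃ C, ∀ x, ‖D3coeff' x‖ ≤ C · exp (−(3 · ∑_{w′} log (max 1 (∑ᵢⱼ ‖adToC w′ (mat x i j)‖))))`
(`hasDecay3_of_bump` at `bump = 1`, `B = 1`, `M = 1 + ∑_{w′} definiteSizeBound w′`). -/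
theorem hasDecay3_D3coeff'_of_definite (w : InfinitePlace k) (hw : w.IsReal) (hcm : IsCMAt q w)
    (ha1 : 0 < (adToC w (algebraMap k (Ad k) (a 1))).re) (ha3 : (adToC w (algebraMap k (Ad k) (-1 * a 3))).re < 0)
    (hdef : ∀ w' : InfinitePlace k, w' ≠ w → w'.IsReal ∧ IsCMAt q w' ∧
      0 < (adToC w' (algebraMap k (Ad k) (a 1))).re * (adToC w' (algebraMap k (Ad k) (-1 * a 3))).re) :
    ∃ C : ℝ, ∀ x : GA ((PlaneData.mixedRow q (a 0) (a 2)).withTransportedTorus g g' hgg' hg'g hgΩ),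
      ‖D3coeff' q a g g' hgg' hg'g hgΩ lam hiso w x‖ ≤
        C * Real.exp (-(3 * ∑ w' : InfinitePlace k, Real.log (max 1 (∑ i : Fin 4, ∑ j : Fin 4,
          ‖adToC w' (GA.mat ((PlaneData.mixedRow q (a 0) (a 2)).withTransportedTorus g g' hgg' hg'g hgΩ) x i j)‖)))) := by
  set M : ℝ := 1 + ∑ w' : InfinitePlace k, definiteSizeBound q a g g' w' with hM
  have hM1 : 1 ≤ M := by
    have : 0 ≤ ∑ w' : InfinitePlace k, definiteSizeBound q a g g' w' :=
      Finset.sum_nonneg fun w' _ => definiteSizeBound_nonneg q a g g' w'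
    linarith
  have hsupp : ∀ x : GA ((PlaneData.mixedRow q (a 0) (a 2)).withTransportedTorus g g' hgg' hg'g hgΩ),
      (fun _ => (1 : ℂ)) x ≠ 0 → ∀ w' : InfinitePlace k, w' ≠ w →
      ∑ i : Fin 4, ∑ j : Fin 4,
        ‖adToC w' (GA.mat ((PlaneData.mixedRow q (a 0) (a 2)).withTransportedTorus g g' hgg' hg'g hgΩ) x i j)‖ ≤ M := by
    intro x _ w' hw'
    obtain ⟨hw'r, hcm', hdef'⟩ := hdef w' hw'
    calc ∑ i : Fin 4, ∑ j : Fin 4,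
          ‖adToC w' (GA.mat ((PlaneData.mixedRow q (a 0) (a 2)).withTransportedTorus g g' hgg' hg'g hgΩ) x i j)‖
        ≤ definiteSizeBound q a g g' w' :=
          sum_norm_adToC_mat_le_of_definite' q a g g' hgg' hg'g hgΩ lam hlam hiso w' hw'r hcm' hdef' x
      _ ≤ ∑ w'' : InfinitePlace k, definiteSizeBound q a g g' w'' :=
          Finset.single_le_sum (f := fun w'' => definiteSizeBound q a g g' w'')
            (fun w'' _ => definiteSizeBound_nonneg q a g g' w'') (Finset.mem_univ w')
      _ ≤ M := by rw [hM]; linarith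
  obtain ⟨C, hC⟩ := hasDecay3_of_bump q a g g' hgg' hg'g hgΩ lam hlam hiso w hw hcm ha1 ha3 (fun _ => (1 : ℂ)) 1 M
    hM1 (fun _ => by simp) hsupp
  exact ⟨C, fun x => by simpa using hC x⟩

end Seesaw

end Summit.Ventures.HodgeRepro.Tier4.Line4

end
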